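import Mathlib.Geometry.Manifold.PartitionOfUnity
import Mathlib.Geometry.Manifold.MFDeriv.Tangent
import Mathlib.Analysis.InnerProductSpace.Calculus
import Mathlib.Analysis.Normed.Module.Alternating.Basic
import Literature.Geometry.Kaehler.ManifoldFormsPullback
import Literature.Geometry.Kaehler.LocalFormsGlue
import HarnessLib

/-!
# A smooth `1`-form evaluating to `1` on a nowhere-vanishing vector field

General differential topology (topic `Geometry/Manifold`), written for step (S1) of the fact
`Literature.Geometry.Symplectic.exists_symplecticCutPieces_of_isOrigamiForm` (Cannas da Silva–
Guillemin–Pires 2010, Prop. 2.8; Cannas da Silva–Guillemin–Woodward 2000, Thm. 1: the Moser model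
`p^*i^*ω + d(t² p^*α)` near the fold needs a **connection form** `α` of the null fibration, i.e. an
invariant `1`-form with `α(X) = 1` on the fundamental vector field `X`; it is obtained by
averaging ANY smooth `1`-form `α₀` with `α₀(X) = 1`).  This file supplies `α₀`:

* `exists_isSmoothForm_apply_eq_one` — on a Hausdorff `σ`-compact manifold `N` modelled on `ℝᵐ`,
  for every smooth nowhere-vanishing vector field `X` there is a smooth `1`-form `α₀`
  (`Literature.Geometry.Kaehler.MForm`, `IsSmoothForm`) with `α₀(X) ≡ 1`.

Proof: in the chart at `x₀` take the flat form `e ↦ ⟪X̂, e⟫ / ‖X̂‖²` (`X̂` = `X` read in the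
chart), pull it back along the chart (`MForm.SmoothAt.pullback`), and glue with a smooth partition
of unity subordinate to the chart sources (`SmoothPartitionOfUnity.exists_isSubordinate`,
`MForm.SmoothAt.fun_smul`).  Everything is proved; no definitions, no named facts.

## References

* J. M. Lee, *Introduction to Smooth Manifolds*, 2nd ed. (2013), Thm. 2.23 (partitions of unity),
  Prop. 13.3 (the same gluing for Riemannian metrics). [LeeSmoothManifolds2013]
* A. Cannas da Silva, V. Guillemin, C. Woodward, *On the unfolding of folded symplectic
  structures*, Math. Res. Lett. 7 (2000), proof of Thm. 1 (connection form of the null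
  fibration). [CannasGuilleminWoodward2000]
-/

noncomputable section

open scoped Manifold ContDiff Topology InnerProductSpace
open Set Function Filter

namespace Literature.Geometry.Manifold

open Literature.Geometry.Kaehler

variable {m : ℕ}

/-! ### The flat local form `e ↦ ⟪Y, e⟫ / ‖Y‖²` -/

section Flat

variable {V : Type*} [NormedAddCommGroup V] [InnerProductSpace ℝ V] {k : ℕ}

/-- In the flat case a form that is `ContDiffAt` (as a map into the space of alternating maps)
is smooth at the point (converse of `Literature.Geometry.Symplectic.contDiffAt_of_smoothAt_self`;
the chart representative of a flat form is the form). [folklore] -/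
theorem MForm.smoothAt_self_of_contDiffAt {β : MForm 𝓘(ℝ, V) V ℝ k} {x : V}
    (h : ContDiffAt ℝ ∞ (E := V) (F := V [⋀^Fin k]→L[ℝ] ℝ) β x) : β.SmoothAt x := by
  show ContDiffWithinAt ℝ ∞ (β.inChart x) (range 𝓘(ℝ, V)) (extChartAt 𝓘(ℝ, V) x x)
  have hself : β.inChart x = β := by
    funext y
    ext v
    simp [MForm.inChart_apply]
    rfl
  rw [hself, modelWithCornersSelf_coe, range_id, extChartAt_self_apply]
  exact h.contDiffWithinAt

/-- The linear form `e ↦ ⟪y, e⟫ / ‖y‖²` as a `1`-form value, and its value. [folklore] -/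
theorem ofSubsingleton_innerSL_apply (y e : V) :
    ContinuousAlternatingMap.ofSubsingleton ℝ V ℝ (0 : Fin 1)
        ((‖y‖ ^ 2)⁻¹ • innerSL ℝ y) ![e] = (‖y‖ ^ 2)⁻¹ * ⟪y, e⟫_ℝ := by
  simp [ContinuousAlternatingMap.ofSubsingleton]

/-- On itself the form `e ↦ ⟪y, e⟫ / ‖y‖²` takes the value `1` (`y ≠ 0`). [folklore] -/
theorem ofSubsingleton_innerSL_apply_self {y : V} (hy : y ≠ 0) :
    ContinuousAlternatingMap.ofSubsingleton ℝ V ℝ (0 : Fin 1)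
        ((‖y‖ ^ 2)⁻¹ • innerSL ℝ y) ![y] = 1 := by
  rw [ofSubsingleton_innerSL_apply, real_inner_self_eq_norm_sq,
    inv_mul_cancel₀ (pow_ne_zero 2 (norm_ne_zero_iff.2 hy))]

/-- **Smoothness of the flat form `q ↦ (e ↦ ⟪Y q, e⟫ / ‖Y q‖²)`** at a point where the
coefficient field `Y` is `C^∞` and non-zero. [folklore] -/
theorem contDiffAt_ofSubsingleton_innerSL {Y : V → V} {q : V} (hY : ContDiffAt ℝ ∞ Y q)
    (hq : Y q ≠ 0) :
    ContDiffAt ℝ ∞ (fun p : V => ContinuousAlternatingMap.ofSubsingleton ℝ V ℝ (0 : Fin 1)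
      ((‖Y p‖ ^ 2)⁻¹ • innerSL ℝ (Y p))) q := by
  have h0 : ContDiffAt ℝ ∞ (fun p : V => (‖Y p‖ ^ 2)⁻¹) q :=
    (hY.norm_sq ℝ).inv (pow_ne_zero 2 (norm_ne_zero_iff.2 hq))
  have h1 : ContDiffAt ℝ ∞ (fun p : V => (‖Y p‖ ^ 2)⁻¹ • innerSL ℝ (Y p)) q :=
    h0.smul ((innerSL ℝ (E := V)).contDiff.contDiffAt.comp q hY)
  exact (ContinuousAlternatingMap.ofSubsingletonLIE (𝕜 := ℝ) (E := V) (F := ℝ)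
    (0 : Fin 1)).toContinuousLinearEquiv.contDiff.contDiffAt.comp q h1

end Flat

/-! ### The local form in a chart -/

section Local

variable {N : Type*} [TopologicalSpace N] [ChartedSpace (EuclideanSpace ℝ (Fin m)) N]
  [IsManifold (𝓡 m) ∞ N]

/-- A smooth section of the tangent bundle read in the trivialisation at `x₀` is `C^∞` on the
chart source. [folklore] -/
theorem contMDiffAt_trivializationAt_section {X : Π n : N, TangentSpace (𝓡 m) n}
    (hX : ContMDiff (𝓡 m) (𝓡 m).tangent ∞ (fun n => (⟨n, X n⟩ : TangentBundle (𝓡 m) N)))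
    {x₀ y : N} (hy : y ∈ (chartAt (EuclideanSpace ℝ (Fin m)) x₀).source) :
    ContMDiffAt (𝓡 m) 𝓘(ℝ, EuclideanSpace ℝ (Fin m)) ∞
      (fun z =>
        (trivializationAt (EuclideanSpace ℝ (Fin m)) (TangentSpace (𝓡 m)) x₀ ⟨z, X z⟩).2) y :=
  ((trivializationAt (EuclideanSpace ℝ (Fin m)) (TangentSpace (𝓡 m)) x₀).contMDiffAt_section_iff
    (by simpa only [TangentBundle.trivializationAt_baseSet] using hy)).1 (hX y)

/-- The same section composed with the inverse chart is `C^∞` on the chart target (as a map of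
the model space). [folklore] -/
theorem contDiffAt_trivializationAt_section_symm {X : Π n : N, TangentSpace (𝓡 m) n}
    (hX : ContMDiff (𝓡 m) (𝓡 m).tangent ∞ (fun n => (⟨n, X n⟩ : TangentBundle (𝓡 m) N)))
    {x₀ : N} {q : EuclideanSpace ℝ (Fin m)} (hq : q ∈ (extChartAt (𝓡 m) x₀).target) :
    ContDiffAt ℝ ∞ (fun p : EuclideanSpace ℝ (Fin m) =>
      (trivializationAt (EuclideanSpace ℝ (Fin m)) (TangentSpace (𝓡 m)) x₀
        ⟨(extChartAt (𝓡 m) x₀).symm p, X ((extChartAt (𝓡 m) x₀).symm p)⟩).2) q := by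
  have hy : (extChartAt (𝓡 m) x₀).symm q ∈ (chartAt (EuclideanSpace ℝ (Fin m)) x₀).source := by
    rw [← extChartAt_source (𝓡 m)]
    exact (extChartAt (𝓡 m) x₀).map_target hq
  have h1 := contMDiffAt_trivializationAt_section hX hy
  have h2 : ContMDiffAt 𝓘(ℝ, EuclideanSpace ℝ (Fin m)) (𝓡 m) ∞ (extChartAt (𝓡 m) x₀).symm q :=
    (contMDiffOn_extChartAt_symm (n := ∞) x₀ q hq).contMDiffAt
      ((isOpen_extChartAt_target (I := 𝓡 m) x₀).mem_nhds hq)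
  exact contMDiffAt_iff_contDiffAt.1 (h1.comp q h2)

/-- Read in the trivialisation at `x₀`, the section at `y = e.symm (e y)` is `dφ_{x₀}(X y)`
(`φ_{x₀}` the extended chart). [folklore] -/
theorem trivializationAt_section_symm_apply (X : Π n : N, TangentSpace (𝓡 m) n) {x₀ y : N}
    (hy : y ∈ (chartAt (EuclideanSpace ℝ (Fin m)) x₀).source) :
    (trivializationAt (EuclideanSpace ℝ (Fin m)) (TangentSpace (𝓡 m)) x₀
        ⟨(extChartAt (𝓡 m) x₀).symm (extChartAt (𝓡 m) x₀ y),
          X ((extChartAt (𝓡 m) x₀).symm (extChartAt (𝓡 m) x₀ y))⟩).2 =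
      mfderiv (𝓡 m) 𝓘(ℝ, EuclideanSpace ℝ (Fin m)) (extChartAt (𝓡 m) x₀) y (X y) := by
  have hy' : y ∈ (extChartAt (𝓡 m) x₀).source := by rwa [extChartAt_source]
  rw [(extChartAt (𝓡 m) x₀).left_inv hy', (hasMFDerivAt_extChartAt (I := 𝓡 m) hy).mfderiv,
    mfderiv_chartAt_eq_tangentCoordChange (I := 𝓡 m) hy]
  rfl

/-- `dφ_{x₀}(v) ≠ 0` for `v ≠ 0` and `y` in the chart source (the tangent coordinate change is
invertible). [folklore] -/
theorem mfderiv_extChartAt_ne_zero {x₀ y : N}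
    (hy : y ∈ (chartAt (EuclideanSpace ℝ (Fin m)) x₀).source)
    {v : TangentSpace (𝓡 m) y} (hv : v ≠ 0) :
    mfderiv (𝓡 m) 𝓘(ℝ, EuclideanSpace ℝ (Fin m)) (extChartAt (𝓡 m) x₀) y v ≠ 0 := by
  rw [(hasMFDerivAt_extChartAt (I := 𝓡 m) hy).mfderiv,
    mfderiv_chartAt_eq_tangentCoordChange (I := 𝓡 m) hy]
  intro h0
  have hy' : y ∈ (extChartAt (𝓡 m) x₀).source := by rwa [extChartAt_source]
  have hmem : y ∈ (extChartAt (𝓡 m) y).source ∩ (extChartAt (𝓡 m) x₀).source ∩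
      (extChartAt (𝓡 m) y).source := ⟨⟨mem_extChartAt_source y, hy'⟩, mem_extChartAt_source y⟩
  have hrt : tangentCoordChange (𝓡 m) x₀ y y (tangentCoordChange (𝓡 m) y x₀ y v) = v := by
    rw [tangentCoordChange_comp hmem]
    exact tangentCoordChange_self (mem_extChartAt_source y)
  have : (v : EuclideanSpace ℝ (Fin m)) = 0 := by
    rw [← hrt]
    exact (congrArg _ h0).trans (map_zero _)
  exact hv this

/-- **A smooth `1`-form with `α(X) ≡ 1` for a nowhere-vanishing smooth vector field `X`** on a
Hausdorff `σ`-compact manifold modelled on `ℝᵐ`: glue the pulled-back flat forms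
`e ↦ ⟪X̂, e⟫ / ‖X̂‖²` of the charts with a smooth partition of unity subordinate to the chart
sources (the Riemannian-metric gluing of Lee, Prop. 13.3, for `1`-forms).
[cite: LeeSmoothManifolds2013, Thm. 2.23 and Prop. 13.3] -/
theorem exists_isSmoothForm_apply_eq_one [T2Space N] [SigmaCompactSpace N]
    {X : Π n : N, TangentSpace (𝓡 m) n}
    (hX : ContMDiff (𝓡 m) (𝓡 m).tangent ∞ (fun n => (⟨n, X n⟩ : TangentBundle (𝓡 m) N)))
    (hX0 : ∀ n, X n ≠ 0) :
    ∃ α : MForm (𝓡 m) N ℝ 1, IsSmoothForm α ∧ ∀ n, α n ![X n] = 1 := by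
  -- the field read in the trivialisation at `x₀`, as a function on the model space
  set Y : N → EuclideanSpace ℝ (Fin m) → EuclideanSpace ℝ (Fin m) := fun x₀ q =>
    (trivializationAt (EuclideanSpace ℝ (Fin m)) (TangentSpace (𝓡 m)) x₀
    ⟨(extChartAt (𝓡 m) x₀).symm q, X ((extChartAt (𝓡 m) x₀).symm q)⟩).2 with hY
  -- the flat local forms and their pull-backs along the charts
  set β : N → MForm 𝓘(ℝ, EuclideanSpace ℝ (Fin m)) (EuclideanSpace ℝ (Fin m)) ℝ 1 := fun x₀ q =>
    ContinuousAlternatingMap.ofSubsingleton ℝ (EuclideanSpace ℝ (Fin m)) ℝ (0 : Fin 1)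
      ((‖Y x₀ q‖ ^ 2)⁻¹ • innerSL ℝ (Y x₀ q)) with hβ
  set αl : N → MForm (𝓡 m) N ℝ 1 := fun x₀ =>
    (β x₀).pullback (I' := 𝓘(ℝ, EuclideanSpace ℝ (Fin m))) (𝓡 m) (extChartAt (𝓡 m) x₀) with hαl
  have hYval : ∀ x₀ y, y ∈ (chartAt (EuclideanSpace ℝ (Fin m)) x₀).source →
      Y x₀ (extChartAt (𝓡 m) x₀ y) =
        mfderiv (𝓡 m) 𝓘(ℝ, EuclideanSpace ℝ (Fin m)) (extChartAt (𝓡 m) x₀) y (X y) :=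
    fun x₀ y hy => trivializationAt_section_symm_apply X hy
  have hsm : ∀ x₀ y, y ∈ (chartAt (EuclideanSpace ℝ (Fin m)) x₀).source → (αl x₀).SmoothAt y := by
    intro x₀ y hy
    have hy' : y ∈ (extChartAt (𝓡 m) x₀).source := by rwa [extChartAt_source]
    refine MForm.SmoothAt.pullback ?_ ?_
    · filter_upwards [(chartAt (EuclideanSpace ℝ (Fin m)) x₀).open_source.mem_nhds hy] with z hz
      exact contMDiffAt_extChartAt' hz
    · refine MForm.smoothAt_self_of_contDiffAt (contDiffAt_ofSubsingleton_innerSL ?_ ?_)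
      · exact contDiffAt_trivializationAt_section_symm hX ((extChartAt (𝓡 m) x₀).map_source hy')
      · rw [hYval x₀ y hy]
        exact mfderiv_extChartAt_ne_zero hy (hX0 y)
  have hval : ∀ x₀ y, y ∈ (chartAt (EuclideanSpace ℝ (Fin m)) x₀).source → αl x₀ y ![X y] = 1 := by
    intro x₀ y hy
    simp only [hαl, MForm.pullback_apply]
    have hvec : (fun i : Fin 1 =>
        mfderiv (𝓡 m) 𝓘(ℝ, EuclideanSpace ℝ (Fin m)) (extChartAt (𝓡 m) x₀) y (![X y] i)) =
        ![mfderiv (𝓡 m) 𝓘(ℝ, EuclideanSpace ℝ (Fin m)) (extChartAt (𝓡 m) x₀) y (X y)] := by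
      funext i
      fin_cases i
      rfl
    rw [hvec, hβ]
    beta_reduce
    rw [hYval x₀ y hy]
    exact ofSubsingleton_innerSL_apply_self (mfderiv_extChartAt_ne_zero hy (hX0 y))
  -- a smooth partition of unity subordinate to the chart sources
  obtain ⟨ρ, hρ⟩ := SmoothPartitionOfUnity.exists_isSubordinate (ι := N) (I := 𝓡 m) (M := N)
    isClosed_univ (fun x₀ : N => (chartAt (EuclideanSpace ℝ (Fin m)) x₀).source)
    (fun x₀ => (chartAt (EuclideanSpace ℝ (Fin m)) x₀).open_source)
    (fun x _ => mem_iUnion.2 ⟨x, mem_chart_source (EuclideanSpace ℝ (Fin m)) x⟩)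
  -- each term `ρ_{x₀} • α_{x₀}` is smooth everywhere and evaluates to `ρ_{x₀}` on `X`
  have hterm : ∀ x₀ y, ((ρ x₀ : N → ℝ) • αl x₀).SmoothAt y := by
    intro x₀ y
    by_cases hy : y ∈ (chartAt (EuclideanSpace ℝ (Fin m)) x₀).source
    · exact (hsm x₀ y hy).fun_smul (ρ x₀).contMDiff.contMDiffAt
    · have h0 : (ρ x₀ : N → ℝ) =ᶠ[𝓝 y] 0 :=
        notMem_tsupport_iff_eventuallyEq.1 fun h => hy (hρ x₀ h)
      refine MForm.smoothAt_of_eventuallyEq_zero (h0.mono fun z hz => ?_)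
      change ρ x₀ z • αl x₀ z = 0
      rw [hz, Pi.zero_apply, zero_smul]
  have htermval : ∀ x₀ y, ((ρ x₀ : N → ℝ) • αl x₀) y ![X y] = ρ x₀ y := by
    intro x₀ y
    change (ρ x₀ y • αl x₀ y) ![X y] = ρ x₀ y
    by_cases hy : y ∈ (chartAt (EuclideanSpace ℝ (Fin m)) x₀).source
    · rw [ContinuousAlternatingMap.smul_apply, hval x₀ y hy, smul_eq_mul, mul_one]
    · have h0 : ρ x₀ y = 0 := by
        by_contra h
        exact hy (hρ x₀ (subset_tsupport _ h))
      rw [h0, zero_smul]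
      rfl
  -- the glued form
  refine ⟨fun y => ∑ᶠ x₀, ((ρ x₀ : N → ℝ) • αl x₀) y, ?_, ?_⟩
  · rw [isSmoothForm_iff_smoothAt]
    intro y
    obtain ⟨W, hW, hfin⟩ := ρ.locallyFinite y
    have hsub : ∀ z ∈ W, (support fun x₀ => ((ρ x₀ : N → ℝ) • αl x₀) z) ⊆ hfin.toFinset := by
      intro z hz x₀ hx₀
      simp only [Finite.coe_toFinset, mem_setOf_eq]
      refine ⟨z, ?_, hz⟩
      intro h0
      apply hx₀
      change ρ x₀ z • αl x₀ z = 0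
      rw [h0, zero_smul]
    have hev : ∀ᶠ z in 𝓝 y, (∑ x₀ ∈ hfin.toFinset, ((ρ x₀ : N → ℝ) • αl x₀)) z =
        ∑ᶠ x₀, ((ρ x₀ : N → ℝ) • αl x₀) z := by
      filter_upwards [hW] with z hz
      rw [Finset.sum_apply, finsum_eq_sum_of_support_subset _ (hsub z hz)]
    refine MForm.SmoothAt.congr_of_eventuallyEq ?_ hev
    exact Finset.sum_induction _ (fun γ : MForm (𝓡 m) N ℝ 1 => γ.SmoothAt y)
      (fun a b ha hb => ha.add hb) (MForm.smoothAt_zero y) (fun x₀ _ => hterm x₀ y)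
  · intro y
    have hsub : (support fun x₀ => ((ρ x₀ : N → ℝ) • αl x₀) y) ⊆
        (ρ.locallyFinite.point_finite y).toFinset := by
      intro x₀ hx₀
      simp only [Finite.coe_toFinset, mem_setOf_eq]
      intro h0
      apply hx₀
      change ρ x₀ y • αl x₀ y = 0
      rw [h0, zero_smul]
    have hsub' : (support fun x₀ => ρ x₀ y) ⊆ (ρ.locallyFinite.point_finite y).toFinset := by
      intro x₀ hx₀
      rw [Function.mem_support] at hx₀
      simp only [Finite.coe_toFinset, mem_setOf_eq, Function.mem_support]
      exact hx₀
    change (∑ᶠ x₀, ((ρ x₀ : N → ℝ) • αl x₀) y) ![X y] = 1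
    rw [finsum_eq_sum_of_support_subset _ hsub, ContinuousAlternatingMap.sum_apply]
    simp only [htermval]
    rw [← finsum_eq_sum_of_support_subset _ hsub']
    exact ρ.sum_eq_one (mem_univ y)

end Local

end Literature.Geometry.Manifold

end
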